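import Summits.AtomisticToContinuum.HydrodynamicLimit.Theorems.OneFlightGossipEngineEquilibriumClampedCollisionalWindowLDCompositionC1
import Summits.AtomisticToContinuum.HydrodynamicLimit.Theorems.OneFlightGossipEngineEquilibriumClampedCollisionalWindowLDOverflowCountMeasurable
import Summits.AtomisticToContinuum.HydrodynamicLimit.Theorems.OneFlightGossipEngineEquilibriumClampedCollisionalWindowLDCompensatorDefectMeasurable

/-!
# Line `coarse-coin-entropy-chain`: the repaired crux C′ from its four PURE large-deviation cores (composition v3, sorry-free)

Crux `Summit.AtomisticToContinuum.HydrodynamicLimit.Theses.TwoClocks.EquilibriumClampedCollisionalWindowLD` (stmt-AtomisticToContinuum-13733;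
byte-identical copy in `Theses.OneFlightGossipEngine`; the FILED decl is Lean-refuted by the standing disprover, class refuted-misstated);
repaired statement C′ = `ClampedTransferCoin.ClampedTransferWindowLD` (CompositionC1, typed verbatim there).

CompositionC1 (`clampedTransferWindowLD_of_LD`, p101830) derives C′ from the four registered LD stubs S3–S6 of the line, two of which
(S3 `ActivityOverflowLD`, S5 `CompensatorDefectLD`) still carried MEASURABILITY side conditions as conjuncts. Both side conditions are
now theorems: `activityOverflow_overflowCount_aemeasurable` (…WindowLDOverflowCountMeasurable, p120290) and
`compensatorDefect_defect_aemeasurable` (…WindowLDCompensatorDefectMeasurable, p120369; for EVERY filtration carrying the coin marks).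
This file RESHAPES the two stubs to their pure large-deviation content —

* S3′ `OverflowCountLD`: the per-particle exponential-moment rate of the number of over-budget particles vanishes (no measurability conjunct);
* S5′ `CompensatorDefectCoreLD`: along SOME filtration carrying the marks (adapted) and the truncated ranges (predictable), the
  non-innovation part of the adapted-clamped transfer is LD-close to the explicit compensator (no `AEMeasurable` conjunct) —

proves `activityOverflowLD_of_core : OverflowCountLD → ActivityOverflowLD` and `compensatorDefectLD_of_core : CompensatorDefectCoreLD →
CompensatorDefectLD` (shrinking `σ₀` below `1/2`, where the torus geometry is hard-sphere regular and the measurability theorems apply),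
and composes: `clampedTransferWindowLD_of_coreLD : OverflowCountLD → CoinBudgetLD → CompensatorDefectCoreLD → RateWindowLD →
ClampedTransferWindowLD`. CONDITIONAL: it closes nothing by itself; its four hypotheses are exactly the open dynamical content of C′ on
this line (registered stubs `stub_activityOverflowLD`, `stub_coinBudgetLD`, `stub_compensatorDefectLD`, `stub_rateWindowLD` of the
lead-owned skeleton `Cruxes/…/Lines/coarse_coin_entropy_chain.lean`, v4). prover-line-stmt-AtomisticToContinuum-13733-c3-0, 2026-08-16.
-/

noncomputable section

open MeasureTheory ProbabilityTheory Set Filter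
open scoped ENNReal BigOperators
open Literature.Analysis.FluidPDE Literature.MathematicalPhysics.KineticTheory
open Literature.Analysis.FunctionSpaces (Torus.partialDeriv Torus.IsSmooth)

namespace Summit.AtomisticToContinuum.HydrodynamicLimit.Theorems.ClampedTransferCoin

/-! ## The two reshaped cores -/

/-- **S3′ · overflow-count LD, pure form** (the registered `stub_activityOverflowLD` of skeleton v4): under the canonical Gibbs law the
NUMBER of particles whose window transfer activity exceeds `V` has vanishing per-particle exponential-moment rate at amplitudes
`s ≤ s₀(V)`, as `τ → ∞` and then `N → ∞`. Content: droplet/cage entropy + a tagged-particle transfer-activity law of large numbers over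
kinetic windows, uniformly in `N` (OPEN). -/
def OverflowCountLD : Prop :=
  ∃ σ₀ : ℝ, 0 < σ₀ ∧ ∀ (a₀ θ₀ : ℝ) (u₀ : V3), 0 < a₀ → 0 < θ₀ → ∀ σ : ℝ, 0 < σ → σ < σ₀ →
      ∀ Φ : (N : ℕ) → Flow σ N, ∃ V₀ : ℝ, 0 < V₀ ∧ ∀ V : ℝ, V₀ ≤ V → ∃ s₀ : ℝ, 0 < s₀ ∧
        ∀ s : ℝ, 0 ≤ s → s ≤ s₀ → ∀ ε : ℝ, 0 < ε → ∃ τ₀ : ℝ, 0 < τ₀ ∧ ∀ τ : ℝ, τ₀ ≤ τ →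
          ∃ N₀ : ℕ, ∀ N : ℕ, N₀ ≤ N →
            ∫⁻ z, ENNReal.ofReal (Real.exp (s * (overflowCount σ τ V (Φ N) z : ℝ))) ∂(gibbs σ a₀ θ₀ u₀ N (Φ N)) ≤
              ENNReal.ofReal (Real.exp (ε * ((N : ℝ) + 1)))

/-- **S5′ · predictable compensator defect LD, pure form** (the registered `stub_compensatorDefectLD` of skeleton v4): for SOME filtration
of phase space along the coins carrying the marks (`T_n ∈ ℱ_{n+1}`) and the truncated ranges (`ρ_n ∈ ℱ_n`) and some horizon `H`,
`w⁻¹ (X̃ − M_H − K_exp)` has vanishing window pressure below an amplitude `p₀(V)` in every row (OPEN — the line's bet; the filtration is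
the lever: with the exact coin filtration `M ≡ 0`). -/
def CompensatorDefectCoreLD : Prop :=
  ∃ σ₀ : ℝ, 0 < σ₀ ∧ ∀ (a₀ θ₀ : ℝ) (u₀ : V3), 0 < a₀ → 0 < θ₀ → ∀ σ : ℝ, 0 < σ → σ < σ₀ →
      ∀ Φ : (N : ℕ) → Flow σ N, ∀ φ : T3 → ℝ, Torus.IsSmooth φ → ∃ V₀ : ℝ, 0 < V₀ ∧ ∀ V : ℝ, V₀ ≤ V →
        ∃ p₀ : ℝ, 0 < p₀ ∧ ∀ p : ℝ, |p| ≤ p₀ → ∀ ε : ℝ, 0 < ε → ∃ τ₀ : ℝ, 0 < τ₀ ∧ ∀ τ : ℝ, τ₀ ≤ τ →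
          ∃ N₀ : ℕ, ∀ N : ℕ, N₀ ≤ N →
            ∃ (ℱ : Filtration ℕ (inferInstance : MeasurableSpace (Phase N))) (H : ℕ),
              (∀ (r : Option (Fin 3)) (n : ℕ), StronglyMeasurable[ℱ (n + 1)] (coinMark σ τ V φ (Φ N) r n)) ∧
              (∀ (r : Option (Fin 3)) (n : ℕ), StronglyMeasurable[ℱ n] (coinRange σ τ V (Φ N) r n)) ∧
              ∀ r : Option (Fin 3),
                ∫⁻ z, ENNReal.ofReal (Real.exp (p * ((window τ N)⁻¹ *
                    (Xa σ τ V φ (Φ N) r z - innov σ a₀ θ₀ u₀ τ V φ (Φ N) ℱ r H z - Kexp σ τ V φ (Φ N) r z))))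
                    ∂(gibbs σ a₀ θ₀ u₀ N (Φ N)) ≤
                  ENNReal.ofReal (Real.exp (ε * ((N : ℝ) + 1)))

/-! ## The reshaped cores imply the registered v2/v3 stubs (measurability discharged) -/

/-- S3′ ⇒ S3: the measurability conjunct of `ActivityOverflowLD` is the theorem `activityOverflow_overflowCount_aemeasurable`
(valid for `σ < 1/2`; the threshold `σ₀` is shrunk accordingly). -/
theorem activityOverflowLD_of_core (h : OverflowCountLD) : ActivityOverflowLD := by
  obtain ⟨σ₀, hσ₀, h⟩ := h
  refine ⟨min σ₀ (1 / 2), lt_min hσ₀ (by norm_num), ?_⟩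
  intro a₀ θ₀ u₀ ha hθ σ hσ hσlt Φ
  have hσ₀' : σ < σ₀ := hσlt.trans_le (min_le_left _ _)
  have hσhalf : σ < 1 / 2 := hσlt.trans_le (min_le_right _ _)
  obtain ⟨V₀, hV₀, h⟩ := h a₀ θ₀ u₀ ha hθ σ hσ hσ₀' Φ
  refine ⟨V₀, hV₀, fun V hV => ?_⟩
  obtain ⟨s₀, hs₀, h⟩ := h V hV
  refine ⟨s₀, hs₀, fun s hs hs' ε hε => ?_⟩
  obtain ⟨τ₀, hτ₀, h⟩ := h s hs hs' ε hε
  refine ⟨τ₀, hτ₀, fun τ hτ => ?_⟩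
  obtain ⟨N₀, h⟩ := h τ hτ
  exact ⟨N₀, fun N hN =>
    ⟨activityOverflow_overflowCount_aemeasurable hσ hσhalf τ V a₀ θ₀ u₀ N (Φ N), h N hN⟩⟩

/-- S5′ ⇒ S5: the `AEMeasurable` conjunct of `CompensatorDefectLD` is the theorem `compensatorDefect_defect_aemeasurable`, valid for
EVERY filtration carrying the marks (and `σ < 1/2`; the threshold `σ₀` is shrunk accordingly). -/
theorem compensatorDefectLD_of_core (h : CompensatorDefectCoreLD) : CompensatorDefectLD := by
  obtain ⟨σ₀, hσ₀, h⟩ := h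
  refine ⟨min σ₀ (1 / 2), lt_min hσ₀ (by norm_num), ?_⟩
  intro a₀ θ₀ u₀ ha hθ σ hσ hσlt Φ φ hφ
  have hσ₀' : σ < σ₀ := hσlt.trans_le (min_le_left _ _)
  have hσhalf : σ < 1 / 2 := hσlt.trans_le (min_le_right _ _)
  obtain ⟨V₀, hV₀, h⟩ := h a₀ θ₀ u₀ ha hθ σ hσ hσ₀' Φ φ hφ
  refine ⟨V₀, hV₀, fun V hV => ?_⟩
  obtain ⟨p₀, hp₀, h⟩ := h V hV
  refine ⟨p₀, hp₀, fun p hp ε hε => ?_⟩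
  obtain ⟨τ₀, hτ₀, h⟩ := h p hp ε hε
  refine ⟨τ₀, hτ₀, fun τ hτ => ?_⟩
  obtain ⟨N₀, h⟩ := h τ hτ
  refine ⟨N₀, fun N hN => ?_⟩
  obtain ⟨ℱ, H, hT, hR, hLD⟩ := h N hN
  exact ⟨ℱ, H, hT, hR, fun r =>
    ⟨compensatorDefect_defect_aemeasurable hσ hσhalf a₀ θ₀ u₀ τ V hφ N (Φ N) ℱ hT r H, hLD r⟩⟩

/-! ## Composition v3 -/

/-- **The composition, v3: the four PURE large-deviation cores (with the landed S1, S2 and the landed measurability theorems) imply the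
repaired crux C′ (all four rows).** A conditional result (registered sub-goal of the line). -/
theorem clampedTransferWindowLD_of_coreLD (h3 : OverflowCountLD) (h4 : CoinBudgetLD) (h5 : CompensatorDefectCoreLD)
    (h6 : RateWindowLD) : ClampedTransferWindowLD :=
  clampedTransferWindowLD_of_LD (activityOverflowLD_of_core h3) h4 (compensatorDefectLD_of_core h5) h6

end Summit.AtomisticToContinuum.HydrodynamicLimit.Theorems.ClampedTransferCoin

end
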